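import Mathlib
import HarnessLib

/-!
# Elliptic bootstrapping for `J`-holomorphic curves in Hölder classes: elementary estimates

Auxiliary real-variable estimates for the Hölder bootstrapping of `J`-holomorphic curves
(`Literature/Geometry/Symplectic/JHolomorphicRegularityHolder.lean`; McDuff–Salamon 2012,
Thm. B.4.1): the product rule for sup / Hölder bounds of `z ↦ P z (w z)`, the passage from a
bounded derivative to a Hölder bound, the three bounds for DIFFERENCE QUOTIENTS
`h⁻¹ (V (z + h e) - V z)` of a map with bounded `r`-Hölder derivative (sup bound `‖DV‖_∞`, Hölder
bound `[DV]_r`, distance `[DV]_r |h|^r` to the directional derivative), and the globalisation of a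
Hölder bound on a disc by a factor supported in a smaller disc. All maps are defined on `ℂ`.

## References

* D. McDuff, D. Salamon, *J-holomorphic curves and symplectic topology*, 2nd ed. (2012),
  App. B.4, Thm. B.4.1. [McDuffSalamon2012]
* D. Gilbarg, N. S. Trudinger, *Elliptic Partial Differential Equations of Second Order* (2001),
  §4.1, §6.1. [GilbargTrudinger2001]
-/

noncomputable section

open Set Metric Filter
open scoped Topology

namespace Literature.Geometry.Symplectic

section Products

variable {Y Z : Type*} [NormedAddCommGroup Y] [NormedSpace ℝ Y] [NormedAddCommGroup Z]
  [NormedSpace ℝ Z]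

/-- The product rule for differences of `P w`: `‖P w - P' w'‖ ≤ ‖P - P'‖ ‖w‖ + ‖P'‖ ‖w - w'‖`.
[folklore] -/
theorem norm_apply_sub_apply_le (P P' : Y →L[ℝ] Z) (w w' : Y) :
    ‖P w - P' w'‖ ≤ ‖P - P'‖ * ‖w‖ + ‖P'‖ * ‖w - w'‖ := by
  have h : P w - P' w' = (P - P') w + P' (w - w') := by
    simp only [sub_apply, map_sub]
    abel
  rw [h]
  exact (norm_add_le _ _).trans (add_le_add ((P - P').le_opNorm w) (P'.le_opNorm _))

/-- **Sup and Hölder bounds for `z ↦ P z (w z)`** from sup and Hölder bounds for the operators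
`P z` and the vectors `w z` (the `C^{0,r}` product rule with explicit constants). [folklore] -/
theorem holder_bound_clm_apply {P : ℂ → Y →L[ℝ] Z} {w : ℂ → Y} {p₀ p₁ q₀ q₁ s : ℝ}
    (hp₀ : ∀ z, ‖P z‖ ≤ p₀) (hp₁ : ∀ z z', ‖P z - P z'‖ ≤ p₁ * ‖z - z'‖ ^ s)
    (hq₀ : ∀ z, ‖w z‖ ≤ q₀) (hq₁ : ∀ z z', ‖w z - w z'‖ ≤ q₁ * ‖z - z'‖ ^ s) :
    (∀ z, ‖P z (w z)‖ ≤ p₀ * q₀) ∧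
      ∀ z z', ‖P z (w z) - P z' (w z')‖ ≤ (p₁ * q₀ + p₀ * q₁) * ‖z - z'‖ ^ s := by
  have hp : 0 ≤ p₀ := (norm_nonneg _).trans (hp₀ 0)
  refine ⟨fun z => (P z).le_of_opNorm_le (hp₀ z) (w z) |>.trans (by gcongr; exact hq₀ z),
    fun z z' => ?_⟩
  have h1 : ‖P z - P z'‖ * ‖w z‖ ≤ p₁ * ‖z - z'‖ ^ s * q₀ :=
    mul_le_mul (hp₁ z z') (hq₀ z) (norm_nonneg _) ((norm_nonneg _).trans (hp₁ z z'))
  have h2 : ‖P z'‖ * ‖w z - w z'‖ ≤ p₀ * (q₁ * ‖z - z'‖ ^ s) :=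
    mul_le_mul (hp₀ z') (hq₁ z z') (norm_nonneg _) hp
  calc ‖P z (w z) - P z' (w z')‖ ≤ ‖P z - P z'‖ * ‖w z‖ + ‖P z'‖ * ‖w z - w z'‖ :=
        norm_apply_sub_apply_le _ _ _ _
    _ ≤ p₁ * ‖z - z'‖ ^ s * q₀ + p₀ * (q₁ * ‖z - z'‖ ^ s) := add_le_add h1 h2
    _ = (p₁ * q₀ + p₀ * q₁) * ‖z - z'‖ ^ s := by ring

omit [NormedSpace ℝ Y] in
/-- Sup and Hölder bounds for a difference. [folklore] -/
theorem holder_bound_sub {w w' : ℂ → Y} {q₀ q₁ q₀' q₁' s : ℝ}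
    (hq₀ : ∀ z, ‖w z‖ ≤ q₀) (hq₁ : ∀ z z', ‖w z - w z'‖ ≤ q₁ * ‖z - z'‖ ^ s)
    (hq₀' : ∀ z, ‖w' z‖ ≤ q₀') (hq₁' : ∀ z z', ‖w' z - w' z'‖ ≤ q₁' * ‖z - z'‖ ^ s) :
    (∀ z, ‖w z - w' z‖ ≤ q₀ + q₀') ∧
      ∀ z z', ‖(w z - w' z) - (w z' - w' z')‖ ≤ (q₁ + q₁') * ‖z - z'‖ ^ s := by
  refine ⟨fun z => (norm_sub_le _ _).trans (add_le_add (hq₀ z) (hq₀' z)), fun z z' => ?_⟩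
  rw [sub_sub_sub_comm, add_mul]
  exact (norm_sub_le _ _).trans (add_le_add (hq₁ z z') (hq₁' z z'))

omit [NormedSpace ℝ Y] in
/-- Sup and Hölder bounds for a sum. [folklore] -/
theorem holder_bound_add {w w' : ℂ → Y} {q₀ q₁ q₀' q₁' s : ℝ}
    (hq₀ : ∀ z, ‖w z‖ ≤ q₀) (hq₁ : ∀ z z', ‖w z - w z'‖ ≤ q₁ * ‖z - z'‖ ^ s)
    (hq₀' : ∀ z, ‖w' z‖ ≤ q₀') (hq₁' : ∀ z z', ‖w' z - w' z'‖ ≤ q₁' * ‖z - z'‖ ^ s) :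
    (∀ z, ‖w z + w' z‖ ≤ q₀ + q₀') ∧
      ∀ z z', ‖(w z + w' z) - (w z' + w' z')‖ ≤ (q₁ + q₁') * ‖z - z'‖ ^ s := by
  refine ⟨fun z => (norm_add_le _ _).trans (add_le_add (hq₀ z) (hq₀' z)), fun z z' => ?_⟩
  rw [add_sub_add_comm, add_mul]
  exact (norm_add_le _ _).trans (add_le_add (hq₁ z z') (hq₁' z z'))

/-- Sup and Hölder bounds for a complex scalar multiple (in a complex normed space). [folklore] -/
theorem holder_bound_const_smul {W : Type*} [NormedAddCommGroup W] [NormedSpace ℂ W] (c : ℂ)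
    {w : ℂ → W} {q₀ q₁ s : ℝ}
    (hq₀ : ∀ z, ‖w z‖ ≤ q₀) (hq₁ : ∀ z z', ‖w z - w z'‖ ≤ q₁ * ‖z - z'‖ ^ s) :
    (∀ z, ‖c • w z‖ ≤ ‖c‖ * q₀) ∧
      ∀ z z', ‖c • w z - c • w z'‖ ≤ ‖c‖ * q₁ * ‖z - z'‖ ^ s := by
  refine ⟨fun z => ?_, fun z z' => ?_⟩
  · rw [norm_smul]
    exact mul_le_mul_of_nonneg_left (hq₀ z) (norm_nonneg c)
  · rw [← smul_sub, norm_smul, mul_assoc]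
    exact mul_le_mul_of_nonneg_left (hq₁ z z') (norm_nonneg c)

end Products

section Lipschitz

variable {Y : Type*} [NormedAddCommGroup Y] [NormedSpace ℝ Y]

/-- **A bounded map with bounded derivative is Hölder**: `‖g z - g z'‖ ≤ (2a + b) ‖z - z'‖ ^ s` for
`0 ≤ s ≤ 1` if `‖g‖ ≤ a` and `‖Dg‖ ≤ b` (mean value theorem for `‖z - z'‖ ≤ 1`, the sup bound
otherwise). [folklore] -/
theorem holder_of_norm_fderiv_le {g : ℂ → Y} (hg : Differentiable ℝ g) {a b s : ℝ}
    (hs0 : 0 ≤ s) (hs : s ≤ 1) (ha : ∀ z, ‖g z‖ ≤ a) (hb : ∀ z, ‖fderiv ℝ g z‖ ≤ b) (z z' : ℂ) :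
    ‖g z - g z'‖ ≤ (2 * a + b) * ‖z - z'‖ ^ s := by
  have ha0 : 0 ≤ a := (norm_nonneg _).trans (ha 0)
  have hb0 : 0 ≤ b := (norm_nonneg _).trans (hb 0)
  have hds : 0 ≤ ‖z - z'‖ ^ s := Real.rpow_nonneg (norm_nonneg _) _
  by_cases hd : ‖z - z'‖ ≤ 1
  · have hmv : ‖g z - g z'‖ ≤ b * ‖z - z'‖ :=
      convex_univ.norm_image_sub_le_of_norm_fderiv_le (fun x _ => hg x) (fun x _ => hb x)
        (mem_univ z') (mem_univ z)
    have h1 : ‖z - z'‖ ≤ ‖z - z'‖ ^ s := Real.self_le_rpow_of_le_one (norm_nonneg _) hd hs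
    calc ‖g z - g z'‖ ≤ b * ‖z - z'‖ ^ s := hmv.trans (mul_le_mul_of_nonneg_left h1 hb0)
      _ ≤ (2 * a + b) * ‖z - z'‖ ^ s := by gcongr; linarith
  · have h1 : 1 ≤ ‖z - z'‖ ^ s := Real.one_le_rpow (le_of_lt (not_le.1 hd)) hs0
    calc ‖g z - g z'‖ ≤ ‖g z‖ + ‖g z'‖ := norm_sub_le _ _
      _ ≤ 2 * a := by linarith [ha z, ha z']
      _ ≤ (2 * a + b) * 1 := by linarith
      _ ≤ (2 * a + b) * ‖z - z'‖ ^ s := by gcongr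

/-- **On a disc, a bounded derivative gives a Hölder bound**:
`‖g z - g z'‖ ≤ b (2ρ)^{1-s} ‖z - z'‖ ^ s` for `z, z'` in `B(z₀, ρ)` when `‖Dg‖ ≤ b` there and
`s ≤ 1` (mean value theorem on the convex disc and `‖z - z'‖ < 2ρ`). [folklore] -/
theorem holder_on_ball_of_norm_fderiv_le {g : ℂ → Y} {z₀ : ℂ} {ρ b s : ℝ}
    (hg : ∀ z ∈ ball z₀ ρ, DifferentiableAt ℝ g z) (hs : s ≤ 1)
    (hb : ∀ z ∈ ball z₀ ρ, ‖fderiv ℝ g z‖ ≤ b) {z z' : ℂ} (hz : z ∈ ball z₀ ρ)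
    (hz' : z' ∈ ball z₀ ρ) :
    ‖g z - g z'‖ ≤ b * (2 * ρ) ^ (1 - s) * ‖z - z'‖ ^ s := by
  have hb0 : 0 ≤ b := (norm_nonneg _).trans (hb z hz)
  have hmv : ‖g z - g z'‖ ≤ b * ‖z - z'‖ :=
    (convex_ball z₀ ρ).norm_image_sub_le_of_norm_fderiv_le hg hb hz' hz
  refine hmv.trans ?_
  rw [mul_assoc]
  refine mul_le_mul_of_nonneg_left ?_ hb0
  have hρ : 0 < ρ := dist_nonneg.trans_lt (mem_ball.1 hz)
  rcases (norm_nonneg (z - z')).eq_or_lt with hd | hd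
  · rw [← hd]
    rcases eq_or_ne s 0 with rfl | hs0
    · simp [hρ.le]
    · rw [Real.zero_rpow hs0, mul_zero]
  · have h2ρ : ‖z - z'‖ ≤ 2 * ρ := by
      have h1 := mem_ball_iff_norm.1 hz
      have h2 := mem_ball_iff_norm.1 hz'
      calc ‖z - z'‖ = ‖(z - z₀) - (z' - z₀)‖ := by rw [sub_sub_sub_cancel_right]
        _ ≤ ‖z - z₀‖ + ‖z' - z₀‖ := norm_sub_le _ _
        _ ≤ 2 * ρ := by linarith
    calc ‖z - z'‖ = ‖z - z'‖ ^ (1 - s) * ‖z - z'‖ ^ s := by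
          rw [← Real.rpow_add hd, sub_add_cancel, Real.rpow_one]
      _ ≤ (2 * ρ) ^ (1 - s) * ‖z - z'‖ ^ s := by
          gcongr

end Lipschitz

section DifferenceQuotients

variable {Y : Type*} [NormedAddCommGroup Y] [NormedSpace ℝ Y]

/-- **Sup bound for difference quotients**: `‖h⁻¹ (V (z + h e) - V z)‖ ≤ a₁ ‖e‖` when `‖DV‖ ≤ a₁`
(mean value theorem). [folklore] -/
theorem norm_diffQuot_le {V : ℂ → Y} (hV : Differentiable ℝ V) {a₁ : ℝ}
    (ha₁ : ∀ z, ‖fderiv ℝ V z‖ ≤ a₁) {h : ℝ} (hh : h ≠ 0) (e z : ℂ) :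
    ‖h⁻¹ • (V (z + h • e) - V z)‖ ≤ a₁ * ‖e‖ := by
  have hmv : ‖V (z + h • e) - V z‖ ≤ a₁ * ‖(z + h • e) - z‖ :=
    convex_univ.norm_image_sub_le_of_norm_fderiv_le (fun x _ => hV x) (fun x _ => ha₁ x)
      (mem_univ z) (mem_univ _)
  rw [add_sub_cancel_left, norm_smul, Real.norm_eq_abs] at hmv
  rw [norm_smul, norm_inv, Real.norm_eq_abs]
  have hpos : 0 < |h| := abs_pos.2 hh
  calc |h|⁻¹ * ‖V (z + h • e) - V z‖ ≤ |h|⁻¹ * (a₁ * (|h| * ‖e‖)) := by gcongr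
    _ = a₁ * ‖e‖ := by field_simp

/-- **Hölder bound for difference quotients**, uniformly in `h`: if `‖DV z - DV z'‖ ≤ a₂ ‖z - z'‖^s`
then `z ↦ h⁻¹ (V (z + h e) - V z)` is `s`-Hölder with constant `a₂ ‖e‖` (mean value theorem for
`x ↦ V x - V (x + (z' - z))`, whose derivative is bounded by `a₂ ‖z - z'‖ ^ s`). [folklore] -/
theorem norm_diffQuot_sub_diffQuot_le {V : ℂ → Y} (hV : Differentiable ℝ V) {a₂ s : ℝ}
    (ha₂ : ∀ z z', ‖fderiv ℝ V z - fderiv ℝ V z'‖ ≤ a₂ * ‖z - z'‖ ^ s) {h : ℝ} (hh : h ≠ 0)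
    (e z z' : ℂ) :
    ‖h⁻¹ • (V (z + h • e) - V z) - h⁻¹ • (V (z' + h • e) - V z')‖ ≤ a₂ * ‖e‖ * ‖z - z'‖ ^ s := by
  set G : ℂ → Y := fun x => V x - V (x + (z' - z)) with hG
  have hsh : ∀ x, DifferentiableAt ℝ (fun x => V (x + (z' - z))) x := fun x =>
    (hV _).comp x (differentiableAt_id.add (differentiableAt_const _))
  have hGd : ∀ x, DifferentiableAt ℝ G x := fun x => (hV x).sub (hsh x)
  have hGf : ∀ x, fderiv ℝ G x = fderiv ℝ V x - fderiv ℝ V (x + (z' - z)) := by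
    intro x
    rw [hG, fderiv_fun_sub (hV x) (hsh x), fderiv_comp_add_right]
  have hGb : ∀ x, ‖fderiv ℝ G x‖ ≤ a₂ * ‖z - z'‖ ^ s := by
    intro x
    rw [hGf]
    have h1 := ha₂ x (x + (z' - z))
    rw [sub_add_cancel_left, norm_neg] at h1
    rwa [norm_sub_rev z' z] at h1
  have hmv : ‖G (z + h • e) - G z‖ ≤ a₂ * ‖z - z'‖ ^ s * ‖(z + h • e) - z‖ :=
    convex_univ.norm_image_sub_le_of_norm_fderiv_le (fun x _ => hGd x) (fun x _ => hGb x)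
      (mem_univ z) (mem_univ _)
  have hGv : G (z + h • e) - G z = (V (z + h • e) - V z) - (V (z' + h • e) - V z') := by
    simp only [hG]
    rw [show z + h • e + (z' - z) = z' + h • e by ring, show z + (z' - z) = z' by ring]
    abel
  rw [add_sub_cancel_left, norm_smul, Real.norm_eq_abs, hGv] at hmv
  rw [← smul_sub, norm_smul, norm_inv, Real.norm_eq_abs]
  have hpos : 0 < |h| := abs_pos.2 hh
  calc |h|⁻¹ * ‖(V (z + h • e) - V z) - (V (z' + h • e) - V z')‖
        ≤ |h|⁻¹ * (a₂ * ‖z - z'‖ ^ s * (|h| * ‖e‖)) := by gcongr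
    _ = a₂ * ‖e‖ * ‖z - z'‖ ^ s := by field_simp

/-- **Difference quotients converge to the directional derivative at rate `|h|^s`**:
`‖h⁻¹ (V (z + h e) - V z) - DV(z) e‖ ≤ a₂ (|h| ‖e‖) ^ s ‖e‖` when `[DV]_s ≤ a₂` (mean value theorem
for `x ↦ V x - DV(z) x` on the disc `B̄(z, |h| ‖e‖)`). [folklore] -/
theorem norm_diffQuot_sub_fderiv_le {V : ℂ → Y} (hV : Differentiable ℝ V) {a₂ s : ℝ} (hs : 0 ≤ s)
    (ha₂ : ∀ z z', ‖fderiv ℝ V z - fderiv ℝ V z'‖ ≤ a₂ * ‖z - z'‖ ^ s) {h : ℝ} (hh : h ≠ 0)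
    (e z : ℂ) :
    ‖h⁻¹ • (V (z + h • e) - V z) - fderiv ℝ V z e‖ ≤ a₂ * (|h| * ‖e‖) ^ s * ‖e‖ := by
  set G : ℂ → Y := fun x => V x - fderiv ℝ V z x with hG
  have hGd : ∀ x, DifferentiableAt ℝ G x := fun x => (hV x).sub (fderiv ℝ V z).differentiableAt
  have hGf : ∀ x, fderiv ℝ G x = fderiv ℝ V x - fderiv ℝ V z := by
    intro x
    rw [hG, fderiv_fun_sub (hV x) (fderiv ℝ V z).differentiableAt, ContinuousLinearMap.fderiv]
  have ha0 : 0 ≤ a₂ := by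
    have h1 := (norm_nonneg _).trans (ha₂ 0 1)
    simpa using h1
  have hGb : ∀ x ∈ closedBall z (|h| * ‖e‖), ‖fderiv ℝ G x‖ ≤ a₂ * (|h| * ‖e‖) ^ s := by
    intro x hx
    rw [hGf]
    refine (ha₂ x z).trans (mul_le_mul_of_nonneg_left ?_ ha0)
    exact Real.rpow_le_rpow (norm_nonneg _) (mem_closedBall_iff_norm.1 hx) hs
  have hmem : z + h • e ∈ closedBall z (|h| * ‖e‖) := by
    rw [mem_closedBall_iff_norm, add_sub_cancel_left, norm_smul, Real.norm_eq_abs]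
  have hmv : ‖G (z + h • e) - G z‖ ≤ a₂ * (|h| * ‖e‖) ^ s * ‖(z + h • e) - z‖ :=
    (convex_closedBall z _).norm_image_sub_le_of_norm_fderiv_le (fun x _ => hGd x) hGb
      (mem_closedBall_self (by positivity)) hmem
  have hGv : G (z + h • e) - G z = (V (z + h • e) - V z) - h • fderiv ℝ V z e := by
    show (V (z + h • e) - fderiv ℝ V z (z + h • e)) - (V z - fderiv ℝ V z z) = _
    rw [map_add, map_smul]
    abel
  rw [add_sub_cancel_left, norm_smul, Real.norm_eq_abs, hGv] at hmv
  have hpos : 0 < |h| := abs_pos.2 hh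
  have hsc : h⁻¹ • (V (z + h • e) - V z) - fderiv ℝ V z e =
      h⁻¹ • ((V (z + h • e) - V z) - h • fderiv ℝ V z e) := by
    simp only [smul_sub, smul_smul, inv_mul_cancel₀ hh, one_smul]
  rw [hsc, norm_smul, norm_inv, Real.norm_eq_abs]
  calc |h|⁻¹ * ‖(V (z + h • e) - V z) - h • fderiv ℝ V z e‖
        ≤ |h|⁻¹ * (a₂ * (|h| * ‖e‖) ^ s * (|h| * ‖e‖)) := by gcongr
    _ = a₂ * (|h| * ‖e‖) ^ s * ‖e‖ := by field_simp

end DifferenceQuotients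

section Cutoff

variable {X Y Z : Type*} [NormedAddCommGroup X] [NormedSpace ℝ X] [NormedAddCommGroup Y]
  [NormedSpace ℝ Y] [NormedAddCommGroup Z] [NormedSpace ℝ Z]

/-- **Globalising a Hölder bound on a disc by a factor supported in a smaller disc.** If `χ`
vanishes off `B̄(z₀, ρ₁)`, `‖χ‖ ≤ c₀`, `[χ]_s ≤ c₁` on `ℂ`, and `P` is bounded by `p₀` and
`s`-Hölder with constant `p₁` on the larger disc `B(z₀, ρ₂)`, then `z ↦ B (χ z) (P z)` is bounded
by `‖B‖ c₀ p₀` and `s`-Hölder on the whole plane with constant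
`‖B‖ (c₁ p₀ + c₀ p₁ + c₀ p₀ / (ρ₂ - ρ₁) ^ s)` (points of the support and points off the larger disc
are `ρ₂ - ρ₁` apart). [folklore] -/
theorem holder_bound_cutoff_bilinear (B : X →L[ℝ] Y →L[ℝ] Z) {χ : ℂ → X} {P : ℂ → Y} {z₀ : ℂ}
    {ρ₁ ρ₂ c₀ c₁ p₀ p₁ s : ℝ} (hρ : ρ₁ < ρ₂) (hs : 0 ≤ s) (hc₀ : 0 ≤ c₀) (hc₁ : 0 ≤ c₁)
    (hp₀ : 0 ≤ p₀) (hp₁ : 0 ≤ p₁)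
    (hχs : ∀ z, χ z ≠ 0 → z ∈ closedBall z₀ ρ₁)
    (hχ₀ : ∀ z, ‖χ z‖ ≤ c₀) (hχ₁ : ∀ z z', ‖χ z - χ z'‖ ≤ c₁ * ‖z - z'‖ ^ s)
    (hP₀ : ∀ z ∈ ball z₀ ρ₂, ‖P z‖ ≤ p₀)
    (hP₁ : ∀ z ∈ ball z₀ ρ₂, ∀ z' ∈ ball z₀ ρ₂, ‖P z - P z'‖ ≤ p₁ * ‖z - z'‖ ^ s) :
    (∀ z, ‖B (χ z) (P z)‖ ≤ ‖B‖ * c₀ * p₀) ∧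
      ∀ z z', ‖B (χ z) (P z) - B (χ z') (P z')‖ ≤
        ‖B‖ * (c₁ * p₀ + c₀ * p₁ + c₀ * p₀ / (ρ₂ - ρ₁) ^ s) * ‖z - z'‖ ^ s := by
  have hsub : closedBall z₀ ρ₁ ⊆ ball z₀ ρ₂ := closedBall_subset_ball hρ
  -- the value vanishes off the support of `χ`
  have hzero : ∀ z, z ∉ ball z₀ ρ₂ → B (χ z) (P z) = 0 := fun z hz => by
    have : χ z = 0 := by
      by_contra h
      exact hz (hsub (hχs z h))
    rw [this, map_zero, zero_apply]
  -- sup bound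
  have hsup : ∀ z, ‖B (χ z) (P z)‖ ≤ ‖B‖ * c₀ * p₀ := by
    intro z
    by_cases hz : z ∈ ball z₀ ρ₂
    · calc ‖B (χ z) (P z)‖ ≤ ‖B‖ * ‖χ z‖ * ‖P z‖ := B.le_opNorm₂ _ _
        _ ≤ ‖B‖ * c₀ * p₀ := by
          gcongr
          · exact hχ₀ z
          · exact hP₀ z hz
    · rw [hzero z hz, norm_zero]
      positivity
  refine ⟨hsup, fun z z' => ?_⟩
  have hd0 : 0 ≤ ‖z - z'‖ ^ s := Real.rpow_nonneg (norm_nonneg _) _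
  have hK : 0 ≤ ‖B‖ * (c₁ * p₀ + c₀ * p₁ + c₀ * p₀ / (ρ₂ - ρ₁) ^ s) := by
    have : 0 ≤ (ρ₂ - ρ₁) ^ s := Real.rpow_nonneg (by linarith) _
    positivity
  -- both points in the larger disc: the product rule
  have hin : ∀ w w', w ∈ ball z₀ ρ₂ → w' ∈ ball z₀ ρ₂ →
      ‖B (χ w) (P w) - B (χ w') (P w')‖ ≤
        ‖B‖ * (c₁ * p₀ + c₀ * p₁ + c₀ * p₀ / (ρ₂ - ρ₁) ^ s) * ‖w - w'‖ ^ s := by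
    intro w w' hw hw'
    have hds : 0 ≤ ‖w - w'‖ ^ s := Real.rpow_nonneg (norm_nonneg _) _
    have e1 : B (χ w) (P w) - B (χ w') (P w') = B (χ w - χ w') (P w) + B (χ w') (P w - P w') := by
      simp only [map_sub, sub_apply]
      abel
    rw [e1]
    have h1 : ‖B (χ w - χ w') (P w)‖ ≤ ‖B‖ * (c₁ * ‖w - w'‖ ^ s) * p₀ :=
      (B.le_opNorm₂ _ _).trans (by
        gcongr
        · exact hχ₁ w w'
        · exact hP₀ w hw)
    have h2 : ‖B (χ w') (P w - P w')‖ ≤ ‖B‖ * c₀ * (p₁ * ‖w - w'‖ ^ s) :=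
      (B.le_opNorm₂ _ _).trans (by
        gcongr
        · exact hχ₀ w'
        · exact hP₁ w hw w' hw')
    have h3 : 0 ≤ ‖B‖ * (c₀ * p₀ / (ρ₂ - ρ₁) ^ s) * ‖w - w'‖ ^ s := by
      have : 0 ≤ (ρ₂ - ρ₁) ^ s := Real.rpow_nonneg (by linarith) _
      positivity
    calc ‖B (χ w - χ w') (P w) + B (χ w') (P w - P w')‖
          ≤ ‖B‖ * (c₁ * ‖w - w'‖ ^ s) * p₀ + ‖B‖ * c₀ * (p₁ * ‖w - w'‖ ^ s) :=
          (norm_add_le _ _).trans (add_le_add h1 h2)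
      _ ≤ ‖B‖ * (c₁ * ‖w - w'‖ ^ s) * p₀ + ‖B‖ * c₀ * (p₁ * ‖w - w'‖ ^ s) +
            ‖B‖ * (c₀ * p₀ / (ρ₂ - ρ₁) ^ s) * ‖w - w'‖ ^ s := le_add_of_nonneg_right h3
      _ = ‖B‖ * (c₁ * p₀ + c₀ * p₁ + c₀ * p₀ / (ρ₂ - ρ₁) ^ s) * ‖w - w'‖ ^ s := by ring
  -- one point in the support, the other off the larger disc: they are far apart
  have hfar : ∀ w w', w' ∉ ball z₀ ρ₂ →
      ‖B (χ w) (P w)‖ ≤ ‖B‖ * (c₁ * p₀ + c₀ * p₁ + c₀ * p₀ / (ρ₂ - ρ₁) ^ s) * ‖w - w'‖ ^ s := by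
    intro w w' hw'
    by_cases hχw : χ w = 0
    · rw [hχw, map_zero, zero_apply, norm_zero]
      exact mul_nonneg hK (Real.rpow_nonneg (norm_nonneg _) _)
    · have hw : w ∈ closedBall z₀ ρ₁ := hχs w hχw
      have hdist : ρ₂ - ρ₁ ≤ ‖w - w'‖ := by
        have h1 := mem_closedBall_iff_norm.1 hw
        have h2 : ρ₂ ≤ ‖w' - z₀‖ := le_of_not_gt fun h => hw' (mem_ball_iff_norm.2 h)
        have h3 : ‖w' - z₀‖ ≤ ‖w' - w‖ + ‖w - z₀‖ := norm_sub_le_norm_sub_add_norm_sub _ _ _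
        rw [norm_sub_rev w' w] at h3
        linarith
      have hρ' : 0 < ρ₂ - ρ₁ := by linarith
      have hq : 1 ≤ ‖w - w'‖ ^ s / (ρ₂ - ρ₁) ^ s := by
        rw [le_div_iff₀ (Real.rpow_pos_of_pos hρ' s), one_mul]
        exact Real.rpow_le_rpow hρ'.le hdist hs
      have hw2 : w ∈ ball z₀ ρ₂ := hsub hw
      calc ‖B (χ w) (P w)‖ ≤ ‖B‖ * c₀ * p₀ := hsup w
        _ ≤ ‖B‖ * c₀ * p₀ * (‖w - w'‖ ^ s / (ρ₂ - ρ₁) ^ s) :=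
            le_mul_of_one_le_right (by positivity) hq
        _ = ‖B‖ * (c₀ * p₀ / (ρ₂ - ρ₁) ^ s) * ‖w - w'‖ ^ s := by ring
        _ ≤ ‖B‖ * (c₁ * p₀ + c₀ * p₁ + c₀ * p₀ / (ρ₂ - ρ₁) ^ s) * ‖w - w'‖ ^ s := by
            gcongr
            have : 0 ≤ (ρ₂ - ρ₁) ^ s := Real.rpow_nonneg hρ'.le _
            nlinarith [mul_nonneg hc₁ hp₀, mul_nonneg hc₀ hp₁]
  by_cases hz : z ∈ ball z₀ ρ₂
  · by_cases hz' : z' ∈ ball z₀ ρ₂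
    · exact hin z z' hz hz'
    · rw [hzero z' hz', sub_zero]
      exact hfar z z' hz'
  · by_cases hz' : z' ∈ ball z₀ ρ₂
    · rw [hzero z hz, zero_sub, norm_neg, norm_sub_rev]
      exact hfar z' z hz
    · rw [hzero z hz, hzero z' hz', sub_zero, norm_zero]
      exact mul_nonneg hK hd0

end Cutoff

end Literature.Geometry.Symplectic
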